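import Literature.AlgebraicGeometry.Motives.HodgeGroupOfCMFamilyRealPointsNondegenerate
import HarnessLib

/-!
# Moonen (5.8) «`Hg = Ker(MT → 𝔾_m)`» ON REAL POINTS for the CM algebra: `Hg(⊕ᵢ V¹_{(Kᵢ,Φᵢ)})(ℝ) =
# {γ ∈ MT(⊕)(ℝ) | ν(γ) = c_s c_{s̄} = 1}` = the real points of `MT` with ONE (equivalently every) unit-modulus eigenvalue

Family `hodge`, lane `lit-hodgefound` (Track 2 foundations library; Layer A3 / A4), layer `Literature/AlgebraicGeometry/Motives`,
sub-namespace `Literature.AlgebraicGeometry.Motives.HodgeStructure` (as `Motives/HodgeGroupOfCMFamilyRealPoints`, whose §4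
polar factorisation `MT(ℝ) = ℝ^×_{>0} · Hg(ℝ)` this file restates as a KERNEL).  THEOREMS ONLY (no definition, no named fact;
D-0026 net debt `0`).

THE PRINTS.  B. Moonen, *An introduction to Mumford–Tate groups* (2004) [Moonen2004MT] (5.8): «`Hg = Ker(MT → 𝔾_m)`» (the
multiplier character).  P. Deligne [Deligne1982HodgeCycles] (held re-edition `paper:doi-10-1007-978-3-540-38955-2-3`) I Example
3.7 (d) (p0026) «since `μ + ιμ = 1` on `S`, `Y(G) ⊂ {Σ n_s e_s + n₀ e₀ | n_s + n_{ιs} = constant}`» — the multiplier `e₀` is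
`c_s c_{s̄}`; I §3 proof of Prop. 3.6 (p0025) «`C = h(i)` acts as `1` on `ℚ(1)`, `C ∈ G⁰(ℝ)`».  M. Green, P. Griffiths, M.
Kerr (2012) [GreenGriffithsKerr2012] §I.B (semi-direct product remark before (I.B.1)) «`M_φ̃ = 𝔾_m · M_φ`».  B. B. Gordon
[Gordon1999HodgeAVSurvey] Remark 2.12 «`Hg(A) ⊆ Ker{Res_{K/ℚ}𝔾_{m/K} → Res_{K₀/ℚ}𝔾_{m/K₀}}`».  J. S. Milne [Milne2017]
Ch. 12 Example 12.27 (b).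

THE OBJECTS.  A finite family of CM fields `Kᵢ` with CM types `Φᵢ` (`I ≠ ∅`); `⊕ᵢ V¹_{(Kᵢ,Φᵢ)} = ofCMFamily Φ`; the real
points `MT(⊕)(ℝ)`, `Hg(⊕)(ℝ)` in `GL(ℝ ⊗ ∏ᵢ Kᵢ)`; the complexification `γ_ℂ` and its eigenvalues `c_s` on the
eigen-basis `e_s`; the MULTIPLIER `ν(γ) = c_s c_{s̄}` (independent of `s` on `MT`, real and positive on `MT(ℝ)`:
`= ‖c_s‖²` by the reality `c_{s̄} = c̄_s`).

WHAT IS PROVED.  **`mem_hodgeGroupBaseChange_real_ofCMFamily_of_forall_mul_apply_conj_smul_eq_one`** (`γ ∈ MT(ℝ)`,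
`γ_ℂ = diag(c)`, `c_s c_{s̄} = 1` ⟹ `γ ∈ Hg(ℝ)`), **`mem_hodgeGroupBaseChange_real_ofCMFamily_iff_mem_mumfordTateGroupBaseChange_real`**
— **`γ ∈ Hg(⊕)(ℝ) ⟺ γ ∈ MT(⊕)(ℝ) ∧ ν(γ) = 1`** (Moonen (5.8) on real points) —,
**`mem_hodgeGroupBaseChange_real_ofCMFamily_of_norm_eq_one`** (`γ ∈ MT(ℝ)` with ONE eigenvalue of modulus `1` lies in
`Hg(ℝ)`: the common modulus of `Motives/HodgeGroupOfCMFamilyRealPoints` §4), `mem_hodgeGroupBaseChange_real_ofCMFamily_iff_exists_norm_eq_one`.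
Mechanism: the tree's `prod_zpow_eq_one_of_balanced_of_forall_orth_of_forall_mul_conj` (balanced = orthogonal + multiplier)
and `mem_hodgeGroupBaseChange_ofCMFamily_of_forall_prod_zpow_eq_one`, by descent `ℝ → ℂ`.

DEVIATIONS / SCOPE.  On points; `ν` is not introduced as a character of an algebraic group but read off the eigenvalues.
NOT HERE: `ℓ`-adic points; the transport to `H¹(∏ᵢ Aᵢ)`.

## References
* [Moonen2004MT] B. Moonen, *An introduction to Mumford–Tate groups* (2004) — (5.8).
* [Deligne1982HodgeCycles] P. Deligne, *Hodge cycles on abelian varieties*, in LNM 900 (1982) — I proof of Prop. 3.6,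
  Example 3.7 (d) (re-edition pp. 25–26).
* [GreenGriffithsKerr2012] M. Green, P. A. Griffiths, M. Kerr, *Mumford–Tate Groups and Domains* (2012) — §I.B.
* [Gordon1999HodgeAVSurvey] B. B. Gordon, *A survey of the Hodge conjecture for abelian varieties* (1999) — Remark 2.12.
* [Milne2017] J. S. Milne, *Algebraic Groups*, CUP (2017) — Ch. 12 Example 12.27 (b).

## Provenance
Lane `lit-hodgefound` (Hodge path, Track 2), prover seat `lit-hodgefound-p29` (generation 21), self-proposed row g21-#10.
-/

noncomputable section

open scoped TensorProduct Classical
open Module NumberField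

namespace Literature.AlgebraicGeometry.Motives

namespace HodgeStructure

open RealMult (embCoords)
open Literature.NumberTheory.ComplexMultiplication
open Literature.AlgebraicGeometry.Pohlmann1968 (CMAlgebra.familyType CMAlgebra.mem_familyType_iff
  CMAlgebra.smul_sigma_mk CMAlgebra.conj_smul_sigma CMAlgebra.isCMTypeWith_familyType CMAlgebra.cmFamilyRank)

variable {I : Type} [Fintype I] [DecidableEq I] {K : I → Type} [∀ i, Field (K i)] [∀ i, NumberField (K i)]
  [∀ i, IsCMField (K i)] (Φ : ∀ i, CMType (K i)) [HodgeTensorFacts.{0, 0}]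

omit [Fintype I] [DecidableEq I] [∀ i, IsCMField (K i)] [HodgeTensorFacts.{0, 0}] in
/-- A non-trivial `∏ᵢ Kᵢ` has a complex embedding of some factor. Private plumbing. [folklore] -/
private theorem nonempty_sigma_of_nontrivial_pi'' [Nontrivial (∀ i, K i)] : Nonempty ((i : I) × (K i →+* ℂ)) := by
  by_contra hS
  rw [not_nonempty_iff] at hS
  have hI : Nonempty I := by
    by_contra hI
    rw [not_nonempty_iff] at hI
    exact not_nontrivial (∀ i, K i) inferInstance
  obtain ⟨i⟩ := hI
  obtain ⟨σ⟩ := (inferInstance : Nonempty (K i →+* ℂ))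
  exact IsEmpty.false (⟨i, σ⟩ : (i : I) × (K i →+* ℂ))

/-- **`MT(ℝ) ∩ {ν = 1} ⊆ Hg(ℝ)`**: a real point of the Mumford–Tate group whose complexification is `diag(c)` with multiplier
`c_s c_{s̄} = 1` lies in the Hodge group (a Pohlmann-balanced character is an orthogonal one plus a multiple of the
multiplier: the tree's `prod_zpow_eq_one_of_balanced_of_forall_orth_of_forall_mul_conj`). [cite: Moonen2004MT, (5.8)]
[cite: Deligne1982HodgeCycles, I Example 3.7 (d) (p. 26)] -/
theorem mem_hodgeGroupBaseChange_real_ofCMFamily_of_forall_mul_apply_conj_smul_eq_one [Nontrivial (∀ i, K i)]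
    {γ : (ℝ ⊗[ℚ] (∀ i, K i)) ≃ₗ[ℝ] (ℝ ⊗[ℚ] (∀ i, K i))} (hγ : γ ∈ (ofCMFamily Φ).mumfordTateGroupBaseChange ℝ)
    {c : ((i : I) × (K i →+* ℂ)) → ℂ} (hγc : ∀ s, glExtendScalars ℝ ℂ (∀ i, K i) γ (cmFamilyBasis K s) = c s • cmFamilyBasis K s)
    (hν : ∀ s, c s * c ((starRingAut : ℂ ≃+* ℂ) • s) = 1) : γ ∈ (ofCMFamily Φ).hodgeGroupBaseChange ℝ := by
  obtain ⟨s₀⟩ := nonempty_sigma_of_nontrivial_pi'' (K := K)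
  obtain ⟨c', hγc', hc'⟩ := (mem_mumfordTateGroupBaseChange_real_ofCMFamily_iff Φ γ).1 hγ
  obtain rfl : c = c' := eq_of_forall_apply_cmFamilyBasis_eq_smul hγc hγc'
  rw [← (ofCMFamily Φ).glExtendScalars_mem_hodgeGroupBaseChange_iff ℝ ℂ]
  exact mem_hodgeGroupBaseChange_ofCMFamily_of_forall_prod_zpow_eq_one Φ hγc fun n hn =>
    prod_zpow_eq_one_of_balanced_of_forall_orth_of_forall_mul_conj Φ s₀
      (ne_zero_of_forall_apply_cmFamilyBasis_eq_smul hγc) hc' hν n hn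

/-- **Moonen (5.8) «`Hg = Ker(MT → 𝔾_m)`» ON REAL POINTS for the CM algebra**: a real automorphism lies in
`Hg(⊕ᵢ V¹_{(Kᵢ,Φᵢ)})(ℝ)` iff it lies in `MT(⊕ᵢ V¹_{(Kᵢ,Φᵢ)})(ℝ)` and its complexification is diagonal with multiplier
`ν = c_s c_{s̄} = 1` (Deligne (d): the multiplier `e₀`; GGK «`M_φ̃ = 𝔾_m · M_φ`»). [cite: Moonen2004MT, (5.8)]
[cite: Deligne1982HodgeCycles, I Example 3.7 (d) (p. 26)] [cite: GreenGriffithsKerr2012, §I.B (semi-direct product remark before (I.B.1))] -/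
theorem mem_hodgeGroupBaseChange_real_ofCMFamily_iff_mem_mumfordTateGroupBaseChange_real [Nontrivial (∀ i, K i)]
    (γ : (ℝ ⊗[ℚ] (∀ i, K i)) ≃ₗ[ℝ] (ℝ ⊗[ℚ] (∀ i, K i))) :
    γ ∈ (ofCMFamily Φ).hodgeGroupBaseChange ℝ ↔ γ ∈ (ofCMFamily Φ).mumfordTateGroupBaseChange ℝ ∧
      ∃ c : ((i : I) × (K i →+* ℂ)) → ℂ, (∀ s, glExtendScalars ℝ ℂ (∀ i, K i) γ (cmFamilyBasis K s) = c s • cmFamilyBasis K s) ∧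
        ∀ s, c s * c ((starRingAut : ℂ ≃+* ℂ) • s) = 1 := by
  constructor
  · intro hγ
    obtain ⟨c, hγc, -⟩ := (mem_hodgeGroupBaseChange_real_ofCMFamily_iff Φ γ).1 hγ
    exact ⟨hodgeGroupBaseChange_le_mumfordTateGroupBaseChange ℝ _ hγ, c, hγc,
      mul_apply_conj_smul_eq_one_of_mem_hodgeGroupBaseChange_real Φ hγ hγc⟩
  · rintro ⟨hγ, c, hγc, hν⟩
    exact mem_hodgeGroupBaseChange_real_ofCMFamily_of_forall_mul_apply_conj_smul_eq_one Φ hγ hγc hν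

/-- **ONE unit-modulus eigenvalue suffices**: a real point of `MT(⊕)(ℝ)` whose complexification has an eigenvalue of
modulus one lies in `Hg(⊕)(ℝ)` — all eigenvalues of a real point of `MT` have the same modulus `t`
(`norm_eq_norm_of_mem_mumfordTateGroupBaseChange_real`), and `ν = c_s c̄_s = ‖c_s‖²` by reality. [cite: Moonen2004MT, (5.8)]
[cite: Deligne1982HodgeCycles, I Example 3.7 (d) (p. 26)] [cite: Milne2017, Ch. 12, Example 12.27 (b)] -/
theorem mem_hodgeGroupBaseChange_real_ofCMFamily_of_norm_eq_one [Nontrivial (∀ i, K i)]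
    {γ : (ℝ ⊗[ℚ] (∀ i, K i)) ≃ₗ[ℝ] (ℝ ⊗[ℚ] (∀ i, K i))} (hγ : γ ∈ (ofCMFamily Φ).mumfordTateGroupBaseChange ℝ)
    {c : ((i : I) × (K i →+* ℂ)) → ℂ} (hγc : ∀ s, glExtendScalars ℝ ℂ (∀ i, K i) γ (cmFamilyBasis K s) = c s • cmFamilyBasis K s)
    {s₀ : (i : I) × (K i →+* ℂ)} (h1 : ‖c s₀‖ = 1) : γ ∈ (ofCMFamily Φ).hodgeGroupBaseChange ℝ := by
  refine mem_hodgeGroupBaseChange_real_ofCMFamily_of_forall_mul_apply_conj_smul_eq_one Φ hγ hγc fun s => ?_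
  rw [apply_conj_smul_eq_conj_of_forall_glExtendScalars_apply_cmFamilyBasis_eq_smul hγc s, Complex.mul_conj,
    Complex.normSq_eq_norm_sq, norm_eq_norm_of_mem_mumfordTateGroupBaseChange_real Φ hγ hγc s s₀, h1]
  norm_num

/-- **`Hg(⊕)(ℝ) = {γ ∈ MT(⊕)(ℝ) | some (equivalently every) eigenvalue of γ_ℂ has modulus 1}`** — the compact real torus
inside `MT(ℝ) = ℝ^×_{>0} × Hg(ℝ)` is cut out by the modulus of the eigenvalues. [cite: Moonen2004MT, (5.8)]
[cite: Milne2017, Ch. 12, Example 12.27 (b), Exercise 12-7] [cite: Deligne1982HodgeCycles, I proof of Prop. 3.6 (p. 25)] -/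
theorem mem_hodgeGroupBaseChange_real_ofCMFamily_iff_exists_norm_eq_one [Nontrivial (∀ i, K i)]
    (γ : (ℝ ⊗[ℚ] (∀ i, K i)) ≃ₗ[ℝ] (ℝ ⊗[ℚ] (∀ i, K i))) :
    γ ∈ (ofCMFamily Φ).hodgeGroupBaseChange ℝ ↔ γ ∈ (ofCMFamily Φ).mumfordTateGroupBaseChange ℝ ∧
      ∃ c : ((i : I) × (K i →+* ℂ)) → ℂ, (∀ s, glExtendScalars ℝ ℂ (∀ i, K i) γ (cmFamilyBasis K s) = c s • cmFamilyBasis K s) ∧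
        ∃ s, ‖c s‖ = 1 := by
  obtain ⟨s₀⟩ := nonempty_sigma_of_nontrivial_pi'' (K := K)
  constructor
  · intro hγ
    obtain ⟨c, hγc, -⟩ := (mem_hodgeGroupBaseChange_real_ofCMFamily_iff Φ γ).1 hγ
    exact ⟨hodgeGroupBaseChange_le_mumfordTateGroupBaseChange ℝ _ hγ, c, hγc, s₀,
      norm_eq_one_of_mem_hodgeGroupBaseChange_real Φ hγ hγc s₀⟩
  · rintro ⟨hγ, c, hγc, s, hs⟩
    exact mem_hodgeGroupBaseChange_real_ofCMFamily_of_norm_eq_one Φ hγ hγc hs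

end HodgeStructure

end Literature.AlgebraicGeometry.Motives

end
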